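import Literature.NumberTheory.Automorphic.JacquetExponentUnique
import HarnessLib

/-!
# Normalised Jacquet modules along a short exact sequence: functoriality, exponents, and the «line» bookkeeping of
# [Casselman1995, §7.1] (`dim r(I) = 2` with a stable line ⇒ the Jacquet characters of a sub and of the quotient)

Generic representation theory over ★ `Representation.normalizedJacquet` ∕ ★ `Representation.jacquetMap` (`Automorphic/JacquetModule`) and ★
`Representation.HasJacquetExponent` (`Automorphic/UnitaryGroupPrincipalSeriesExponents`); theorems only (no definition, no named fact, no
instance).  For a parabolic triple `t = (P, M, N)` of a topological group `G`:
* §1 `jacquetMap` intertwines the NORMALISED Jacquet actions (the twist `δ_P^{-1/2}` is the same scalar on both sides); exponents pass along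
  a `G`-map whose Jacquet map is injective (`HasJacquetExponent.map_of_injective`).
* §2 if `r(ρ)` has a stable LINE `ℓ` on which `M` acts by `θ₁` and modulo which `M` acts by `θ₂` (the shape of ★
  `UnitaryGroup.U3PrincipalSeriesJacquetFiltration`, [Casselman1995, L. 7.1.1 (a)]), every exponent of `ρ` is `θ₁` or `θ₂`
  (`HasJacquetExponent.eq_or_eq_of_line`).
* §3 THE BOOKKEEPING ([Casselman1995, proof of Cor. 7.1.2 ∕ Prop. 7.1.3]): for `G`-maps `σ → ρ → τ` whose Jacquet maps are injective,
  exact, surjective (★ `Representation.jacquet_exact`), with `r(ρ)` two-dimensional with such a line, `θ₁ ≠ θ₂`, `r(σ) ≠ 0` and `θ₁` NOT an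
  exponent of `σ`: `r(σ)` is a line on which `M` acts by `θ₂` and `r(τ)` is a line on which `M` acts by `θ₁`; both as `M`-equivalences
  with the characters (`Nonempty (… .Equiv ((trivial ℂ M ℂ).twist θ))`, the currency of the T3 Lines stub `HasJacquetChar`).
Written for the T3 «KeysCaseTwo» pay-down of cell pub/hodgecm-mathlib F0∕P3 (stub S2 `stub_labelledPair_of_reducible`), automorphic-free.

## References
[Casselman1995] W. Casselman, *Introduction to the theory of admissible representations of p-adic reductive groups* (draft 1 May 1995),
§3.2 (exactness of `V ↦ V_N`), §4.4 (exponents), §6.4 Prop. 6.4.1, §7.1 L. 7.1.1, Cor. 7.1.2, Prop. 7.1.3 · [BernsteinZelevinsky1977] §1.8–§1.9, §2.3.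
-/

set_option autoImplicit false

noncomputable section

namespace Representation

open Literature.NumberTheory.Automorphic

variable {G : Type*} [Group G] [TopologicalSpace G] [IsTopologicalGroup G]
  (t : ParabolicTriple G) [LocallyCompactSpace t.P]
  {V₁ V₂ V₃ : Type*} [AddCommGroup V₁] [Module ℂ V₁] [AddCommGroup V₂] [Module ℂ V₂] [AddCommGroup V₃] [Module ℂ V₃]
  {ρ₁ : Representation ℂ G V₁} {ρ₂ : Representation ℂ G V₂} {ρ₃ : Representation ℂ G V₃}

/-! ## §1 Functoriality of the normalised Jacquet module; transport of exponents -/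

/-- **`r(f)` intertwines the NORMALISED Jacquet actions**: `r(f) (δ^{-1/2}(m) [ρ₁ m v]) = δ^{-1/2}(m) [ρ₂ m (f v)]`.
[cite: BernsteinZelevinsky1977, §1.8, §2.3] [cite: Casselman1995, §3.1] -/
theorem jacquetMap_normalizedJacquet (f : ρ₁.IntertwiningMap ρ₂) (m : ↥t.M) (x : (t.restrict ρ₁).Coinvariants) :
    jacquetMap t f (ρ₁.normalizedJacquet t m x) = ρ₂.normalizedJacquet t m (jacquetMap t f x) := by
  obtain ⟨v, rfl⟩ := Representation.Coinvariants.mk_surjective _ x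
  rw [normalizedJacquet_mk, map_smul, jacquetMap_mk, jacquetMap_mk, normalizedJacquet_mk,
    Representation.IntertwiningMap.isIntertwining]

/-- **Exponents pass along a `G`-map with injective Jacquet map** (e.g. a subrepresentation, by exactness ★ `jacquet_exact`).
[cite: Casselman1995, §4.4 p. 45; Prop. 3.2.3] -/
theorem HasJacquetExponent.map_of_injective {χ : ↥t.M →* ℂˣ} (h : ρ₁.HasJacquetExponent t χ) (f : ρ₁.IntertwiningMap ρ₂)
    (hf : Function.Injective (jacquetMap t f)) : ρ₂.HasJacquetExponent t χ := by
  obtain ⟨w, hw0, hw⟩ := h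
  refine ⟨jacquetMap t f w, fun h0 => hw0 (hf (by rw [h0, map_zero])), fun m => ?_⟩
  rw [← jacquetMap_normalizedJacquet, hw m, map_smul]

/-! ## §2 Exponents of a Jacquet module with a stable line -/

/-- **If `r(ρ)` has a stable line `ℓ` with character `θ₁` and quotient character `θ₂`, every exponent of `ρ` is `θ₁` or `θ₂`**: an
eigenvector in `ℓ` has eigencharacter `θ₁`; one outside `ℓ` has `(ψ(m) − θ₂(m)) w ∈ ℓ`, forcing `ψ(m) = θ₂(m)`.
[cite: Casselman1995, L. 7.1.1 (a), Prop. 6.4.1] -/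
theorem HasJacquetExponent.eq_or_eq_of_line {θ₁ θ₂ ψ : ↥t.M →* ℂˣ} (ℓ : Submodule ℂ (t.restrict ρ₂).Coinvariants)
    (hℓ : ∀ (m : ↥t.M), ∀ x ∈ ℓ, ρ₂.normalizedJacquet t m x = ((θ₁ m : ℂˣ) : ℂ) • x)
    (hq : ∀ (m : ↥t.M) (x : (t.restrict ρ₂).Coinvariants), ρ₂.normalizedJacquet t m x - ((θ₂ m : ℂˣ) : ℂ) • x ∈ ℓ)
    (h : ρ₂.HasJacquetExponent t ψ) : ψ = θ₁ ∨ ψ = θ₂ := by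
  obtain ⟨w, hw0, hw⟩ := h
  by_cases hwℓ : w ∈ ℓ
  · left
    ext m
    have h1 := hw m
    rw [hℓ m w hwℓ] at h1
    have h2 : (((θ₁ m : ℂˣ) : ℂ) - ((ψ m : ℂˣ) : ℂ)) • w = 0 := by rw [sub_smul, h1, sub_self]
    rcases smul_eq_zero.1 h2 with h3 | h3
    · exact congrArg Units.val (Units.val_injective (sub_eq_zero.1 h3)).symm ▸ rfl
    · exact absurd h3 hw0
  · right
    ext m
    have h1 := hq m w
    rw [hw m, ← sub_smul] at h1
    by_contra hne
    have hne' : ((ψ m : ℂˣ) : ℂ) - ((θ₂ m : ℂˣ) : ℂ) ≠ 0 := fun h0 => hne (congrArg Units.val (Units.val_injective (sub_eq_zero.1 h0)))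
    exact hwℓ (by simpa only [smul_smul, inv_mul_cancel₀ hne', one_smul] using ℓ.smul_mem (((ψ m : ℂˣ) : ℂ) - ((θ₂ m : ℂˣ) : ℂ))⁻¹ h1)

/-! ## §3 The bookkeeping along `σ ↪ ρ ↠ τ` -/

section Line

variable {θ₁ θ₂ : ↥t.M →* ℂˣ}

/-- **The sub: `r(σ)` is a LINE on which `M` acts by `θ₂`.**  Hypotheses: `r(f) : r(σ) → r(ρ)` injective; `r(ρ)` two-dimensional with a
stable line `ℓ` (character `θ₁`, quotient character `θ₂`); `r(σ) ≠ 0`; `θ₁` is not an exponent of `σ`.  Then `dim r(σ) = 1` (if it were `2`,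
`r(f)` would be onto and `ℓ` would pull back to a `θ₁`-eigenline) and, a generator `x₀` having image `y ∉ ℓ` (else `θ₁` would be an exponent),
`(r(σ)(m) x₀ − θ₂(m) x₀)` maps into `ℓ ∩ ℂy = 0`. [cite: Casselman1995, Cor. 7.1.2, Prop. 7.1.3, Prop. 6.4.1] -/
theorem finrank_eq_one_and_normalizedJacquet_eq_of_line (f : ρ₁.IntertwiningMap ρ₂) (hf : Function.Injective (jacquetMap t f))
    [FiniteDimensional ℂ (t.restrict ρ₂).Coinvariants] (h2 : Module.finrank ℂ (t.restrict ρ₂).Coinvariants = 2)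
    (ℓ : Submodule ℂ (t.restrict ρ₂).Coinvariants) (hℓ1 : Module.finrank ℂ ↥ℓ = 1)
    (hℓ : ∀ (m : ↥t.M), ∀ x ∈ ℓ, ρ₂.normalizedJacquet t m x = ((θ₁ m : ℂˣ) : ℂ) • x)
    (hq : ∀ (m : ↥t.M) (x : (t.restrict ρ₂).Coinvariants), ρ₂.normalizedJacquet t m x - ((θ₂ m : ℂˣ) : ℂ) • x ∈ ℓ)
    [Nontrivial (t.restrict ρ₁).Coinvariants] (hno : ¬ ρ₁.HasJacquetExponent t θ₁) :
    Module.finrank ℂ (t.restrict ρ₁).Coinvariants = 1 ∧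
      ∀ (m : ↥t.M) (x : (t.restrict ρ₁).Coinvariants), ρ₁.normalizedJacquet t m x = ((θ₂ m : ℂˣ) : ℂ) • x := by
  set F : (t.restrict ρ₁).Coinvariants →ₗ[ℂ] (t.restrict ρ₂).Coinvariants := (jacquetMap t f).toLinearMap with hFdef
  have hF : ∀ x, F x = jacquetMap t f x := fun x => rfl
  have hFi : Function.Injective F := hf
  haveI : FiniteDimensional ℂ (t.restrict ρ₁).Coinvariants := Module.Finite.of_injective F hFi
  -- `θ₁`-eigenvectors of `r(ρ)` do not come from `r(σ)`
  have key : ∀ w : (t.restrict ρ₁).Coinvariants, F w ∈ ℓ → w = 0 := by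
    intro w hw
    by_contra hw0
    refine hno ⟨w, hw0, fun m => hf ?_⟩
    rw [jacquetMap_normalizedJacquet, map_smul]
    exact hℓ m _ hw
  have hle : Module.finrank ℂ (t.restrict ρ₁).Coinvariants ≤ 2 := h2 ▸ LinearMap.finrank_le_finrank_of_injective hFi
  have hpos : 0 < Module.finrank ℂ (t.restrict ρ₁).Coinvariants := Module.finrank_pos
  have hne2 : Module.finrank ℂ (t.restrict ρ₁).Coinvariants ≠ 2 := by
    intro h
    have hFs : Function.Surjective F := (LinearMap.injective_iff_surjective_of_finrank_eq_finrank (h.trans h2.symm)).1 hFi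
    have hℓ0 : ℓ ≠ ⊥ := fun h0 => by rw [h0, finrank_bot] at hℓ1; exact zero_ne_one hℓ1
    obtain ⟨y, hy, hy0⟩ := Submodule.exists_mem_ne_zero_of_ne_bot hℓ0
    obtain ⟨w, rfl⟩ := hFs y
    exact hy0 (by rw [key w hy, map_zero])
  have h1 : Module.finrank ℂ (t.restrict ρ₁).Coinvariants = 1 := by omega
  refine ⟨h1, ?_⟩
  obtain ⟨x₀, hx₀⟩ := exists_ne (0 : (t.restrict ρ₁).Coinvariants)
  have hgen := (finrank_eq_one_iff_of_nonzero' x₀ hx₀).1 h1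
  have hx₀m : ∀ m : ↥t.M, ρ₁.normalizedJacquet t m x₀ = ((θ₂ m : ℂˣ) : ℂ) • x₀ := by
    intro m
    obtain ⟨c, hc⟩ := hgen (ρ₁.normalizedJacquet t m x₀)
    have hmem : F (ρ₁.normalizedJacquet t m x₀ - ((θ₂ m : ℂˣ) : ℂ) • x₀) ∈ ℓ := by
      rw [map_sub, map_smul, hF, jacquetMap_normalizedJacquet]
      exact hq m _
    rw [← hc, ← sub_smul, map_smul] at hmem
    by_cases hd : c - ((θ₂ m : ℂˣ) : ℂ) = 0
    · rw [← hc, sub_eq_zero.1 hd]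
    · have hx₀ℓ : F x₀ ∈ ℓ := by
        simpa only [smul_smul, inv_mul_cancel₀ hd, one_smul] using ℓ.smul_mem (c - ((θ₂ m : ℂˣ) : ℂ))⁻¹ hmem
      exact absurd (key x₀ hx₀ℓ) hx₀
  intro m x
  obtain ⟨c, rfl⟩ := hgen x
  rw [map_smul, hx₀m m, smul_comm]

/-- **The quotient: `r(τ)` is a LINE on which `M` acts by `θ₁`**, for `σ → ρ → τ` with `r(f)` injective, `r(f), r(g)` exact and `r(g)`
surjective (★ `jacquet_exact`), `θ₁ ≠ θ₂`: `dim r(τ) = 2 − 1`, and the image of `ℓ` is a non-zero `θ₁`-eigenvector (were `ℓ ≤ r(f)(r(σ))`,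
`θ₁` would act on `r(σ)`, on which `θ₂` acts). [cite: Casselman1995, L. 7.1.1 (a), Cor. 7.1.2, Prop. 3.2.3] -/
theorem finrank_eq_one_and_normalizedJacquet_eq_quot_of_line (f : ρ₁.IntertwiningMap ρ₂) (g : ρ₂.IntertwiningMap ρ₃)
    (hf : Function.Injective (jacquetMap t f)) (hfg : Function.Exact (jacquetMap t f) (jacquetMap t g))
    (hg : Function.Surjective (jacquetMap t g))
    [FiniteDimensional ℂ (t.restrict ρ₂).Coinvariants] (h2 : Module.finrank ℂ (t.restrict ρ₂).Coinvariants = 2)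
    (ℓ : Submodule ℂ (t.restrict ρ₂).Coinvariants) (hℓ1 : Module.finrank ℂ ↥ℓ = 1)
    (hℓ : ∀ (m : ↥t.M), ∀ x ∈ ℓ, ρ₂.normalizedJacquet t m x = ((θ₁ m : ℂˣ) : ℂ) • x)
    (hq : ∀ (m : ↥t.M) (x : (t.restrict ρ₂).Coinvariants), ρ₂.normalizedJacquet t m x - ((θ₂ m : ℂˣ) : ℂ) • x ∈ ℓ)
    (hne : θ₁ ≠ θ₂) [Nontrivial (t.restrict ρ₁).Coinvariants] (hno : ¬ ρ₁.HasJacquetExponent t θ₁) :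
    FiniteDimensional ℂ (t.restrict ρ₃).Coinvariants ∧ Module.finrank ℂ (t.restrict ρ₃).Coinvariants = 1 ∧
      ∀ (m : ↥t.M) (z : (t.restrict ρ₃).Coinvariants), ρ₃.normalizedJacquet t m z = ((θ₁ m : ℂˣ) : ℂ) • z := by
  obtain ⟨h1, hσ⟩ := finrank_eq_one_and_normalizedJacquet_eq_of_line t f hf h2 ℓ hℓ1 hℓ hq hno
  set F : (t.restrict ρ₁).Coinvariants →ₗ[ℂ] (t.restrict ρ₂).Coinvariants := (jacquetMap t f).toLinearMap with hFdef
  set Q : (t.restrict ρ₂).Coinvariants →ₗ[ℂ] (t.restrict ρ₃).Coinvariants := (jacquetMap t g).toLinearMap with hQdef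
  have hF : ∀ x, F x = jacquetMap t f x := fun x => rfl
  have hQ : ∀ x, Q x = jacquetMap t g x := fun x => rfl
  have hFi : Function.Injective F := hf
  have hQs : Function.Surjective Q := hg
  have hex : LinearMap.ker Q = LinearMap.range F := LinearMap.exact_iff.1 hfg
  haveI : FiniteDimensional ℂ (t.restrict ρ₁).Coinvariants := Module.Finite.of_injective F hFi
  haveI hfd : FiniteDimensional ℂ (t.restrict ρ₃).Coinvariants := Module.Finite.of_surjective Q hQs
  have h3 : Module.finrank ℂ (t.restrict ρ₃).Coinvariants = 1 := by
    have hrn := LinearMap.finrank_range_add_finrank_ker Q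
    rw [LinearMap.range_eq_top.2 hQs, finrank_top, hex, LinearMap.finrank_range_of_inj hFi, h1, h2] at hrn
    omega
  refine ⟨hfd, h3, ?_⟩
  -- the image `z₀` of a generator `y₀` of `ℓ`
  have hℓ0 : ℓ ≠ ⊥ := fun h0 => by rw [h0, finrank_bot] at hℓ1; exact zero_ne_one hℓ1
  obtain ⟨y₀, hy₀, hy₀0⟩ := Submodule.exists_mem_ne_zero_of_ne_bot hℓ0
  have hz₀ : Q y₀ ≠ 0 := by
    intro hQ0
    have hyk : y₀ ∈ LinearMap.range F := hex ▸ (LinearMap.mem_ker.2 hQ0)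
    obtain ⟨w, hw⟩ := hyk
    have hw0 : w ≠ 0 := fun h => hy₀0 (by rw [← hw, h, map_zero])
    apply hne
    ext m
    -- `θ₁(m) w = θ₂(m) w`
    have hA : jacquetMap t f (ρ₁.normalizedJacquet t m w) = jacquetMap t f (((θ₁ m : ℂˣ) : ℂ) • w) := by
      rw [jacquetMap_normalizedJacquet, map_smul]
      change ρ₂.normalizedJacquet t m (F w) = ((θ₁ m : ℂˣ) : ℂ) • F w
      rw [hw, hℓ m _ hy₀]
    have hB := hf hA
    rw [hσ m w] at hB
    have hC : (((θ₂ m : ℂˣ) : ℂ) - ((θ₁ m : ℂˣ) : ℂ)) • w = 0 := by rw [sub_smul, hB, sub_self]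
    rcases smul_eq_zero.1 hC with hD | hD
    · exact congrArg Units.val (Units.val_injective (sub_eq_zero.1 hD)).symm ▸ rfl
    · exact absurd hD hw0
  have hz₀m : ∀ m : ↥t.M, ρ₃.normalizedJacquet t m (Q y₀) = ((θ₁ m : ℂˣ) : ℂ) • Q y₀ := fun m => by
    rw [hQ, ← jacquetMap_normalizedJacquet, hℓ m _ hy₀, map_smul]
  have hgen := (finrank_eq_one_iff_of_nonzero' (Q y₀) hz₀).1 h3
  intro m z
  obtain ⟨c, rfl⟩ := hgen z
  rw [map_smul, hz₀m m, smul_comm]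

end Line

/-! ## §4 From «`M` acts by `θ` on a line» to an `M`-equivalence with the character -/

/-- **A one-dimensional Jacquet module on which `M` acts by `θ` IS the character `θ`**: any linear `r(ρ) ≃ ℂ` is an
`M`-equivalence with `(trivial ℂ M ℂ) ⊗ θ`. [cite: Casselman1995, Prop. 6.4.1] [cite: BernsteinZelevinsky1977, Cor. 2.13 (c)] -/
theorem nonempty_normalizedJacquet_equiv_twist_of_finrank_eq_one {θ : ↥t.M →* ℂˣ} [FiniteDimensional ℂ (t.restrict ρ₁).Coinvariants]
    (h1 : Module.finrank ℂ (t.restrict ρ₁).Coinvariants = 1)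
    (hθ : ∀ (m : ↥t.M) (x : (t.restrict ρ₁).Coinvariants), ρ₁.normalizedJacquet t m x = ((θ m : ℂˣ) : ℂ) • x) :
    Nonempty ((ρ₁.normalizedJacquet t).Equiv ((Representation.trivial ℂ ↥t.M ℂ).twist θ)) := by
  let e : (t.restrict ρ₁).Coinvariants ≃ₗ[ℂ] ℂ := LinearEquiv.ofFinrankEq _ _ (h1.trans (Module.finrank_self ℂ).symm)
  refine ⟨Representation.Equiv.mk e fun m => LinearMap.ext fun x => ?_⟩
  simp [hθ m x]

/-- … hence `θ` IS an exponent (any non-zero vector). [cite: Casselman1995, §4.4 p. 45] -/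
theorem hasJacquetExponent_of_forall_eq_smul {θ : ↥t.M →* ℂˣ} [Nontrivial (t.restrict ρ₁).Coinvariants]
    (hθ : ∀ (m : ↥t.M) (x : (t.restrict ρ₁).Coinvariants), ρ₁.normalizedJacquet t m x = ((θ m : ℂˣ) : ℂ) • x) :
    ρ₁.HasJacquetExponent t θ := by
  obtain ⟨x₀, hx₀⟩ := exists_ne (0 : (t.restrict ρ₁).Coinvariants)
  exact ⟨x₀, hx₀, fun m => hθ m x₀⟩

end Representation

end
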